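import Literature.AlgebraicGeometry.Motives.CurveGeneralDivisorsOpen
import Literature.AlgebraicGeometry.Motives.H0FieldExtension
import HarnessLib

/-!
# `h⁰(Σᵢ tᵢ)` at field-valued points of `Cᵍ`; general tuples of `L`-valued points
# (Milne, *Jacobian Varieties*, §4 Prop. 4.2 (a), §5 Lemma 5.2 (b))

`Motives/CurveGeneralDivisorsOpen` defines the open general locus
`{t ∈ Cᵍ : h⁰(Σᵢ tᵢ) = 1}` through the residue fields `κ(t)`. To exhibit points of it one needs to
read `h⁰` at field-valued points `τ : Spec L → Cᵍ` (e.g. tuples of `L`-rational points) rather than at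
residue fields; this file does that:

* `univDivisor_fieldPoint_linEquiv`, `h0_univDivisor_fieldPoint` — `D_τ ∼ Σᵢ Δ|_{C × {τᵢ}}` and
  `h⁰(C_L, D_τ) = ℓ(Σᵢ τᵢ)` over `L` (`coordDivisorAt`, a divisor of the function field of `C_L / L`),
  for every field-valued point `τ` (as in `h0_univDivisor_fibre`);
* `toResiduePt`, `toResiduePt_residuePtι` — the factorisation `Spec L → Spec κ(t₀) → Cᵍ` of `τ` through
  the residue field of its image `t₀` (Mathlib `Scheme.descResidueField`);
* **`h0_univDivisor_fieldPoint_eq_fibre`** — `h⁰(C_L, D_τ) = h⁰(C_{κ(t₀)}, D_{t₀})`: `h⁰` is invariant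
  under the field extension `κ(t₀) ⊆ L` (`h0_classPullback_whiskerLeft_fieldExt_eq` of
  `Motives/H0FieldExtension`, cohomology and flat base change); hence
  `ell_coordDivisorAt_eq : ℓ_L(Σᵢ τᵢ) = ℓ_{κ(t₀)}(Σᵢ (t₀)ᵢ)` and
  **`imagePtPow_mem_generalLocus_iff`** — `t₀` is general iff `ℓ(Σᵢ τᵢ) = 1` over `L`;
* `tuplePt Q : Spec L → Cᵍ` — the tuple of `L`-valued points `Q₁, …, Q_g` (`liftOver`), and
  **`imagePtPow_tuplePt_mem_generalLocus`** — if `ℓ(Σᵢ Qᵢ) = 1` on `C_L` then the image of the tuple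
  lies in the general locus (with `exists_ell_sum_single_eq_one` of
  `NumberTheory/DiophantineGeometry/FunctionFieldNonspecialDivisors`, Milne Lemma 5.2 (b), this makes
  the general locus non-empty as soon as `C` has `2g − 1` rational points over `L`).

Everything is proved; no named facts (D-0026). Part of the construction of the Jacobian
(`nonempty_jacobian_of_isSmoothProjective`).

## References

* J. S. Milne, *Jacobian Varieties*, in: Arithmetic Geometry (Cornell–Silverman, eds.), Springer
  1986, §4 Prop. 4.2 (a), §5 Lemma 5.2 (pp. 248–251 of the volume). [Milne1986JacobianVarieties]
* U. Görtz, T. Wedhorn, *Algebraic Geometry II* (2023), Cor. 22.91. [GortzWedhorn2023]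
-/

noncomputable section

open CategoryTheory CategoryTheory.Limits AlgebraicGeometry IsLocalRing Order TopologicalSpace
  MonoidalCategory CartesianMonoidalCategory

universe u

namespace Literature.AlgebraicGeometry.Motives

open Literature.AlgebraicGeometry.RelativeSpec

namespace CurvePlaces

open RatFn FieldPoint CartierDivisor Literature.NumberTheory.DiophantineGeometry
  Literature.NumberTheory.DiophantineGeometry.AlgFunctionField

variable {K : Type u} [Field K]

section FieldPoint

variable (C : SchemeOver K) [IsIntegral C.left] [SmoothOfRelativeDimension 1 C.hom] [IsProper C.hom]
  [GeometricallyIntegral C.hom] (g : ℕ) {L : Type u} [Field L] (π : Spec (.of L) ⟶ Spec (.of K))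
  (τ : Over.mk π ⟶ powC C g)

omit [IsIntegral C.left] [SmoothOfRelativeDimension 1 C.hom] [IsProper C.hom] [GeometricallyIntegral C.hom] in
/-- The base change of `τ : Spec L → Cᵍ` to `C` followed by `pr_{0,i}` is the fibre inclusion of
`C × {τᵢ}`. [folklore] -/
theorem whisker_prC (i : Fin g) :
    (C ◁ τ).left ≫ prC C g i = fibreIncl C π (τ ≫ coord C g i) := by
  change (C ◁ τ ≫ C ◁ coord C g i).left = (C ◁ (τ ≫ coord C g i)).left
  rw [← MonoidalCategory.whiskerLeft_comp]

/-- **`D_τ ∼ Σᵢ Δ|_{C × {τᵢ}}`** for a field-valued point `τ` of `Cᵍ`. [cite: Milne1986JacobianVarieties, §3 Example 3.12] -/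
theorem univDivisor_fieldPoint_linEquiv :
    ((univDivisor C g).classPullback (C ◁ τ).left).LinEquiv
      (sumDivisor fun i ↦ diagonalFibre C π (τ ≫ coord C g i)) := by
  refine (classPullback_sumDivisor_linEquiv _ _).trans (sumDivisor_linEquiv fun i ↦ ?_)
  refine ((diagonalDivisor C).classPullback_comp_linEquiv (prC C g i) (C ◁ τ).left).symm.trans ?_
  rw [whisker_prC]
  exact (diagonalFibre_linEquiv_classPullback C _ _).symm

/-- The divisor `Σᵢ τᵢ` of the function field of `C_L`, for a field-valued point `τ` of `Cᵍ`. [folklore] -/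
def coordDivisorAt : Divisor L (curveBC C π).left.functionField :=
  ∑ i, Finsupp.single (place (curveBC C π) (ratPtPoint C π (τ ≫ coord C g i))
    (ratPtPoint_ne_genericPoint C _ _)) 1

/-- **`h⁰(D_τ) = ℓ(Σᵢ τᵢ)` over `L`** for a field-valued point `τ : Spec L → Cᵍ`. [cite: Milne1986JacobianVarieties, §3 Example 3.12] -/
theorem h0_univDivisor_fieldPoint :
    letI := fibreOverField C π
    ((univDivisor C g).classPullback (C ◁ τ).left).h0 L = ell (coordDivisorAt C g π τ) := by
  letI := fibreOverField C π
  have h1 := toDivisor_sumDivisor (curveBC C π) (fun i ↦ diagonalFibre C π (τ ≫ coord C g i))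
  rw [(univDivisor_fieldPoint_linEquiv C g π τ).h0_eq (K := L)]
  rw [show coordDivisorAt C g π τ =
      toDivisor (curveBC C π) (sumDivisor fun i ↦ diagonalFibre C π (τ ≫ coord C g i)) by
    rw [h1]; exact (Finset.sum_congr rfl fun i _ ↦ toDivisor_diagonalFibre C _ _).symm]
  exact h0_eq_ell (C := curveBC C π) _

/-! ### Through the residue field of the image point -/

/-- The image point `t₀ ∈ Cᵍ` of the field-valued point `τ`. [folklore] -/
abbrev imagePtPow : (powC C g).left := τ.left (closedPoint L)

/-- The factorisation `Spec L → Spec κ(t₀) → Cᵍ` of `τ` through the residue field of its image, as a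
`K`-morphism `Spec L → Spec κ(t₀)`. [folklore] -/
def toResiduePt : Over.mk π ⟶ residuePt (powC C g) (imagePtPow C g π τ) :=
  haveI : IsLocalHom (Scheme.stalkClosedPointTo τ.left).hom :=
    Scheme.isLocalHom_stalkClosedPointTo' (R := L) τ.left
  Over.homMk (Spec.map ((powC C g).left.descResidueField (Scheme.stalkClosedPointTo τ.left))) (by
    have h := Scheme.descResidueField_stalkClosedPointTo_fromSpecResidueField L _ τ.left
    change Spec.map _ ≫ ((powC C g).left.fromSpecResidueField _ ≫ (powC C g).hom) = π
    refine (Category.assoc _ _ _).symm.trans ?_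
    refine (congrArg (· ≫ (powC C g).hom) h).trans ?_
    exact Over.w τ)

omit [IsIntegral C.left] [SmoothOfRelativeDimension 1 C.hom] [IsProper C.hom] [GeometricallyIntegral C.hom] in
/-- `τ = (Spec L → Spec κ(t₀)) ≫ (Spec κ(t₀) → Cᵍ)`. [folklore] -/
theorem toResiduePt_residuePtι :
    toResiduePt C g π τ ≫ residuePtι (powC C g) (imagePtPow C g π τ) = τ := by
  haveI : IsLocalHom (Scheme.stalkClosedPointTo τ.left).hom :=
    Scheme.isLocalHom_stalkClosedPointTo' (R := L) τ.left
  ext : 1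
  exact Scheme.descResidueField_stalkClosedPointTo_fromSpecResidueField L _ τ.left

/-- **`h⁰` at a field-valued point is `h⁰` at its image point**: the `L`-dimension of
`Γ(C_L, 𝒪(D_τ))` equals the `κ(t₀)`-dimension of `Γ(C_{κ(t₀)}, 𝒪(D_{t₀}))`
(`h0_classPullback_whiskerLeft_fieldExt_eq` along `L ⊇ κ(t₀)`). [cite: GortzWedhorn2023, Cor. 22.91 (p. 388)] -/
theorem h0_univDivisor_fieldPoint_eq_fibre :
    letI := fibreOverField C π
    letI := fibreOverResidueField C (powC C g) (imagePtPow C g π τ)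
    ((univDivisor C g).classPullback (C ◁ τ).left).h0 L =
      ((univDivisor C g).classPullback (C ◁ residuePtι (powC C g) (imagePtPow C g π τ)).left).h0
        ((powC C g).left.residueField (imagePtPow C g π τ)) := by
  letI := fibreOverField C π
  set t₀ := imagePtPow C g π τ
  have hcomp : (C ◁ τ).left =
      (C ◁ toResiduePt C g π τ).left ≫ (C ◁ residuePtι (powC C g) t₀).left := by
    rw [← Over.comp_left, ← MonoidalCategory.whiskerLeft_comp, toResiduePt_residuePtι]
  rw [classPullback_congr hcomp,
    ((univDivisor C g).classPullback_comp_linEquiv (C ◁ residuePtι (powC C g) t₀).left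
      (C ◁ toResiduePt C g π τ).left).h0_eq (K := L)]
  exact h0_classPullback_whiskerLeft_fieldExt_eq C (toResiduePt C g π τ)
    ((univDivisor C g).classPullback (C ◁ residuePtι (powC C g) t₀).left)

/-- **`ℓ(Σᵢ τᵢ)` over `L` is `ℓ(Σᵢ (t₀)ᵢ)` over `κ(t₀)`**: the Riemann–Roch dimension of the
coordinate divisor is the same at a field-valued point and at its image point. [folklore] -/
theorem ell_coordDivisorAt_eq : ell (coordDivisorAt C g π τ) = ell (coordDivisor C g (imagePtPow C g π τ)) := by
  rw [← h0_univDivisor_fieldPoint, h0_univDivisor_fieldPoint_eq_fibre, h0_univDivisor_fibre]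
  rfl

/-- **The image point of `τ` is general iff `ℓ(Σᵢ τᵢ) = 1` over `L`.** [cite: Milne1986JacobianVarieties, §4 Prop. 4.2 (a)] -/
theorem imagePtPow_mem_generalLocus_iff :
    imagePtPow C g π τ ∈ generalLocus C g ↔ ell (coordDivisorAt C g π τ) = 1 := by
  rw [mem_generalLocus_iff, ell_coordDivisorAt_eq]

end FieldPoint

/-! ### General tuples of `L`-valued points -/

section Tuples

variable (C : SchemeOver K) [IsIntegral C.left] [SmoothOfRelativeDimension 1 C.hom] [IsProper C.hom]
  [GeometricallyIntegral C.hom] {L : Type u} [Field L] (π : Spec (.of L) ⟶ Spec (.of K))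

/-- The tuple `(Q₁, …, Q_g) : Spec L → Cᵍ` of `L`-valued points. [folklore] -/
def tuplePt {g : ℕ} (Q : Fin g → (Over.mk π ⟶ C)) : Over.mk π ⟶ powC C g := liftOver C.hom g Q

omit [IsIntegral C.left] [SmoothOfRelativeDimension 1 C.hom] [IsProper C.hom] [GeometricallyIntegral C.hom] in
/-- The coordinates of the tuple are the `Qᵢ`. [folklore] -/
@[simp] theorem tuplePt_coord {g : ℕ} (Q : Fin g → (Over.mk π ⟶ C)) (i : Fin g) :
    tuplePt C π Q ≫ coord C g i = Q i := liftOver_projOver C.hom g Q i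

/-- **A tuple of `L`-valued points with `ℓ(Σᵢ Qᵢ) = 1` (computed on `C_L`) has general image in
`Cᵍ`**; in particular the general locus is then non-empty. [cite: Milne1986JacobianVarieties, §4 Prop. 4.2 (a) and §5 Lemma 5.2 (b)] -/
theorem imagePtPow_tuplePt_mem_generalLocus {g : ℕ} (Q : Fin g → (Over.mk π ⟶ C))
    (h : ell (∑ i, Finsupp.single (place (curveBC C π) (ratPtPoint C π (Q i))
      (ratPtPoint_ne_genericPoint C _ _)) (1 : ℤ)) = 1) :
    imagePtPow C g π (tuplePt C π Q) ∈ generalLocus C g := by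
  rw [imagePtPow_mem_generalLocus_iff]
  convert h using 3
  simp only [coordDivisorAt, tuplePt_coord]

end Tuples

end CurvePlaces

end Literature.AlgebraicGeometry.Motives
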